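import Summits.Ventures.MM22.Rank333.Wang333LPCert
import HarnessLib

/-!
# MM22 venture, Route D3-STRETCH — Wang's `⟨3,3,3⟩/𝔽₂` table, top layer as unconditional `Cert` statements

HONEST FRAMING (cell `pub-mm22`, seat p3 g3). With the fourteen codimension-2 bounds kernel-certified by the LP chain
(`Wang333LPCert.lean`: `cert_478` … `cert_491`), the hypotheses `hyps` of the top-layer replay (`WangTop333*.lean`) are
discharged, so EVERY orbit of the top data `Top333.os` — the three codimension-1 orbits `[1]`, `[10]`, `[84]` at `19`, the
seventeen codimension-2 representatives, and the root at `20` — is an unconditional kernel statement `Cert 3 3 3 K b`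
(every bilinear computation over `𝔽₂` of `(X, Y) ↦ X Y` on `S_K × 𝔽₂^{3×3}` has at least `b` products). These are Wang's
printed values (arXiv:2603.07280), nothing higher; exported here by name for downstream conditional objects (e.g.
`Root21CliqueCover.rankGe21F2_of_480`, hypotheses `h492`, `h493`). No new bound is claimed.
-/

set_option Elab.async false

namespace Summit.Ventures.MM22.GF2Cert.Top333

open Summit.MatrixMultiplication.OmegaCensus.GF2RankLB Literature.Computability.AlgebraicComplexity
open Summit.Ventures.MM22.GF2Cert Summit.Ventures.MM22.GF2Cert.LP333 Summit.Ventures.MM22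

/-- The fourteen codimension-2 hypotheses of the top-layer replay hold (LP chain). -/
theorem hyps_hold : ∀ e ∈ hyps, Cert 3 3 3 (kOf os e.1) e.2 := by
  intro e he
  simp only [hyps, List.mem_cons, List.not_mem_nil, or_false] at he
  rcases he with rfl | rfl | rfl | rfl | rfl | rfl | rfl | rfl | rfl | rfl | rfl | rfl | rfl | rfl
  exacts [cert_478, cert_479, cert_480, cert_481, cert_482, cert_483, cert_484, cert_485, cert_486, cert_487, cert_488,
    cert_489, cert_490, cert_491]

/-- **Every orbit of the top layer is certified at Wang's value** (unconditional). -/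
theorem cert_top (i : ℕ) (hi : i < os.length) : Cert 3 3 3 (kOf os i) (bnd os i) :=
  sweepJ (n := 3) os hyps trs okJ_all (fun i hi => obligs_top333 i (by rw [os_length] at hi; exact hi)) hyps_hold i hi

/-- **Codimension-1 orbit `[1]` of Wang's table: `Cert 3 3 3 [1] 19`** (top orbit 17). -/
theorem cert_codim1_1 : Cert 3 3 3 [1] 19 := by
  have h := cert_top 17 (by rw [os_length]; decide)
  rw [show kOf os 17 = [1] by decide +kernel, show bnd os 17 = 19 by decide +kernel] at h; exact h

/-- **Codimension-1 orbit `[10]`: `Cert 3 3 3 [10] 19`** (top orbit 18). -/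
theorem cert_codim1_10 : Cert 3 3 3 [10] 19 := by
  have h := cert_top 18 (by rw [os_length]; decide)
  rw [show kOf os 18 = [10] by decide +kernel, show bnd os 18 = 19 by decide +kernel] at h; exact h

/-- **Codimension-1 orbit `[84]`: `Cert 3 3 3 [84] 19`** (top orbit 19). -/
theorem cert_codim1_84 : Cert 3 3 3 [84] 19 := by
  have h := cert_top 19 (by rw [os_length]; decide)
  rw [show kOf os 19 = [84] by decide +kernel, show bnd os 19 = 19 by decide +kernel] at h; exact h

/-- **The root: `Cert 3 3 3 [] 20`** — every bilinear computation of `3 × 3` matrix multiplication over `𝔽₂` has at least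
20 products (top orbit 20; the same content as `rankGe20F2_holds`, in `Cert` form). -/
theorem cert_root : Cert 3 3 3 [] 20 := by
  have h := cert_top 20 (by rw [os_length]; decide)
  rw [show kOf os 20 = [] by decide +kernel, show bnd os 20 = 20 by decide +kernel] at h; exact h

end Summit.Ventures.MM22.GF2Cert.Top333
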